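import Summits.Ventures.PercRepro.C041TriDomGlueClassesS

/-!
# ROW C-041 — GLUING AT A CUT VERTEX, IV: THEOREM (CUT-VERTEX GLUING FOR THE DOMINATION CONJECTURE), ON ANY BASE STATUS
(p6, gen 45; P6-TWOEXIT-LEAN.md §53 ADDENDUM 16; the base status `st` is arbitrary — the all-free host is `st = fun _ => free` — so that the theorem can be iterated over the cut vertices of a host)

**THEOREM (CUT-VERTEX GLUING)** (`cycDominationS_of_cutVertex`).  Let `v` be a vertex of the all-free host, `z ≠ v` a
mark, and let the marks `x, y` lie off the `z`-side of `v` (so `v` separates `z` from `x, y`; `v` itself is not a mark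
in the interesting case).  If the host with the `z`-side deleted (`stOut`) satisfies CONJECTURE (STOCHASTIC
DOMINATION) for the marks `(x, y, v)` AND the sibling domination `SibDominationS` for `(x, y; v)`, then the whole
host satisfies the conjecture for `(x, y, z)`.

PROOF (the fibre count).  Write every colouring as `merge o i` (outside part `o`, inside part `i`,
`card_filter_eq_sum_fibre`) and sort the fibres by the `(v, z)`-type of `i` under `stIn`: by `cycCrossed_merge_iff`
/ `topBot_merge_iff` the `D`-fibres carry the classes of `(x, y, v)` under `stOut` (bounded fibre by fibre by the
conjecture on `stOut`, at the up-set `fun ω => V (merge ω i)`), the `R`-fibres the sibling's second class against the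
sibling's target, the `B`-fibres the sibling's first class against NOTHING.  THE TRANSPORT: THEOREM (TWO-MARK
DOMINATION) on `stIn` gives (Hall, `exists_monotone_injection`) a red-ward injection `φ` of the `B`-type inside
parts into the `R`-type ones; since `V` is an up-set the first-class count of a `B`-fibre `i` is at most that of the
`R`-fibre `φ i`; summing, the first-class counts of all `B`-fibres are absorbed into the `R`-fibres, where the sibling
domination bounds «first class + second class» by the target.  No injection on the outside parts is ever built.
-/

namespace PercRepro

namespace ZoneZ

namespace MultiExit

open ZoneData Finset

variable {V₁ E₁ U₁ U₂ : Type} (Z₁ : ZoneData V₁ E₁ U₁ U₂) (st : E₁ → EStat) (x y z v : V₁)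

variable [Fintype E₁] [DecidableEq E₁]

/-! ## The two-mark domination on a status, exclusive form -/

open Classical in
/-- THEOREM (TWO-MARK DOMINATION) on a status, as a count of filtered colourings. -/
theorem count_blue_le_count_red_S (st : E₁ → EStat) (a b : V₁) {V : (E₁ → Bool) → Prop} (hV : UpSet V) :
    (univ.filter fun ω : E₁ → Bool => V ω ∧ MgS Z₁ st ω a b).card ≤
      (univ.filter fun ω : E₁ → Bool => V ω ∧ RdS Z₁ st ω a b).card := by
  have h := cntB_le_cntR Z₁ a b st hV
  unfold cntB cntR at h
  rw [Finset.card_filter, Finset.card_filter]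
  exact_mod_cast h

open Classical in
/-- The exclusive form on a status: «blue-connected, not red-connected» is outnumbered by «red-connected, not
blue-connected» on every up-set. -/
theorem count_blue_only_le_count_red_only_S (st : E₁ → EStat) (a b : V₁) {V : (E₁ → Bool) → Prop}
    (hV : UpSet V) :
    (univ.filter fun ω : E₁ → Bool => V ω ∧ (MgS Z₁ st ω a b ∧ ¬ RdS Z₁ st ω a b)).card ≤
      (univ.filter fun ω : E₁ → Bool => V ω ∧ (RdS Z₁ st ω a b ∧ ¬ MgS Z₁ st ω a b)).card := by
  have h := count_blue_le_count_red_S Z₁ st a b hV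
  have hB : (univ.filter fun ω : E₁ → Bool => V ω ∧ MgS Z₁ st ω a b).card =
      (univ.filter fun ω : E₁ → Bool => V ω ∧ (MgS Z₁ st ω a b ∧ ¬ RdS Z₁ st ω a b)).card
        + (univ.filter fun ω : E₁ → Bool => V ω ∧ (MgS Z₁ st ω a b ∧ RdS Z₁ st ω a b)).card := by
    rw [← Finset.card_union_of_disjoint]
    · congr 1
      ext ω
      simp only [Finset.mem_filter, Finset.mem_univ, true_and, Finset.mem_union]
      tauto
    · rw [Finset.disjoint_left]
      intro ω h1 h2
      simp only [Finset.mem_filter, Finset.mem_univ, true_and] at h1 h2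
      exact h1.2.2 h2.2.2
  have hR : (univ.filter fun ω : E₁ → Bool => V ω ∧ RdS Z₁ st ω a b).card =
      (univ.filter fun ω : E₁ → Bool => V ω ∧ (RdS Z₁ st ω a b ∧ ¬ MgS Z₁ st ω a b)).card
        + (univ.filter fun ω : E₁ → Bool => V ω ∧ (MgS Z₁ st ω a b ∧ RdS Z₁ st ω a b)).card := by
    rw [← Finset.card_union_of_disjoint]
    · congr 1
      ext ω
      simp only [Finset.mem_filter, Finset.mem_univ, true_and, Finset.mem_union]
      tauto
    · rw [Finset.disjoint_left]
      intro ω h1 h2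
      simp only [Finset.mem_filter, Finset.mem_univ, true_and] at h1 h2
      exact h1.2.2 h2.2.1
  omega

/-! ## The classes of `stOut` see the outside part only -/

/-- The inside part of the inside part is the inside part. -/
theorem inN_inN (In : E₁ → Prop) [DecidablePred In] (ω : E₁ → Bool) : inN In (inN In ω) = inN In ω :=
  inN_eq_self In (inN_mem_InSupp In ω)

omit [Fintype E₁] [DecidableEq E₁] in
/-- The count of a filter does not depend on the decidability instance. -/
theorem card_filter_inst {α : Type} {s : Finset α} {p : α → Prop} {i₁ i₂ : DecidablePred p} :
    (@Finset.filter α p i₁ s).card = (@Finset.filter α p i₂ s).card := by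
  congr 1
  ext a
  simp only [Finset.mem_filter]

omit [Fintype E₁] [DecidableEq E₁] in
/-- Equivalent predicates have equal filter counts, whatever the decidability instances. -/
theorem card_filter_congr' {α : Type} {s : Finset α} {p q : α → Prop} {i₁ : DecidablePred p}
    {i₂ : DecidablePred q} (h : ∀ a ∈ s, p a ↔ q a) :
    (@Finset.filter α p i₁ s).card = (@Finset.filter α q i₂ s).card := by
  congr 1
  ext a
  simp only [Finset.mem_filter]
  exact and_congr_right (h a)

omit [Fintype E₁] [DecidableEq E₁] in
open Classical in
/-- The crossed classes of `stOut` depend only on the outside part. -/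
theorem cycCrossedS_stOutS_merge (o i : E₁ → Bool) :
    CycCrossedS Z₁ x y v (stOutS Z₁ st v z) (merge (InCS Z₁ st v z) o i) ↔ CycCrossedS Z₁ x y v (stOutS Z₁ st v z) o := by
  rw [cycCrossedS_iff, cycCrossedS_iff]
  simp only [RdS_stOutS_merge, MgS_stOutS_merge]

omit [Fintype E₁] [DecidableEq E₁] in
open Classical in
/-- The class `(⊤, ⊥)` of `stOut` depends only on the outside part. -/
theorem topBotS_stOutS_merge (o i : E₁ → Bool) :
    TopBotS Z₁ x y v (stOutS Z₁ st v z) (merge (InCS Z₁ st v z) o i) ↔ TopBotS Z₁ x y v (stOutS Z₁ st v z) o := by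
  rw [topBotS_iff, topBotS_iff]
  simp only [RdS_stOutS_merge, MgS_stOutS_merge]

omit [Fintype E₁] [DecidableEq E₁] in
open Classical in
/-- The sibling's first class of `stOut` depends only on the outside part. -/
theorem sibC₁_stOutS_merge (o i : E₁ → Bool) :
    SibC₁ Z₁ x y v (stOutS Z₁ st v z) (merge (InCS Z₁ st v z) o i) ↔ SibC₁ Z₁ x y v (stOutS Z₁ st v z) o := by
  unfold SibC₁
  simp only [RdS_stOutS_merge, MgS_stOutS_merge]

omit [Fintype E₁] [DecidableEq E₁] in
open Classical in
/-- The sibling's second class of `stOut` depends only on the outside part. -/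
theorem sibC₃_stOutS_merge (o i : E₁ → Bool) :
    SibC₃ Z₁ x y v (stOutS Z₁ st v z) (merge (InCS Z₁ st v z) o i) ↔ SibC₃ Z₁ x y v (stOutS Z₁ st v z) o := by
  unfold SibC₃
  simp only [RdS_stOutS_merge, MgS_stOutS_merge]

omit [Fintype E₁] [DecidableEq E₁] in
open Classical in
/-- The sibling's target of `stOut` depends only on the outside part. -/
theorem sibTop_stOutS_merge (o i : E₁ → Bool) :
    SibTop Z₁ x y v (stOutS Z₁ st v z) (merge (InCS Z₁ st v z) o i) ↔ SibTop Z₁ x y v (stOutS Z₁ st v z) o := by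
  unfold SibTop
  simp only [RdS_stOutS_merge, MgS_stOutS_merge]

/-! ## The fibre counts -/

open Classical in
/-- The number of outside parts `o` with `merge o i ∈ V` and `P o`: the fibre count of `P` over the inside part `i`. -/
noncomputable def fibCS (V P : (E₁ → Bool) → Prop) (i : E₁ → Bool) : ℕ :=
  ((OutSupp (InCS Z₁ st v z)).filter fun o => V (merge (InCS Z₁ st v z) o i) ∧ P o).card

open Classical in
/-- A fibre count is monotone in the inside part along an up-set. -/
theorem fibS_mono {V : (E₁ → Bool) → Prop} (hV : UpSet V) (P : (E₁ → Bool) → Prop) {i j : E₁ → Bool}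
    (hij : LeCol i j) : fibCS Z₁ st z v V P i ≤ fibCS Z₁ st z v V P j := by
  unfold fibCS
  apply Finset.card_le_card
  intro o ho
  rw [Finset.mem_filter] at ho ⊢
  exact ⟨ho.1, hV _ _ ho.2.1 (leCol_merge_right _ o hij), ho.2.2⟩

open Classical in
/-- The fibre count of a disjunction of disjoint predicates is the sum. -/
theorem fibS_or {V P Q : (E₁ → Bool) → Prop} (hPQ : ∀ o, P o → ¬ Q o) (i : E₁ → Bool) :
    fibCS Z₁ st z v V (fun o => P o ∨ Q o) i = fibCS Z₁ st z v V P i + fibCS Z₁ st z v V Q i := by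
  unfold fibCS
  beta_reduce
  rw [← Finset.card_union_of_disjoint]
  · congr 1
    ext o
    simp only [Finset.mem_filter, Finset.mem_union]
    tauto
  · rw [Finset.disjoint_left]
    intro o h1 h2
    rw [Finset.mem_filter] at h1 h2
    exact hPQ o h1.2.2 h2.2.2

open Classical in
/-- A count of an outside-only predicate over all colourings, fibre-wise. -/
theorem card_outOnly_eq_fibS {V : (E₁ → Bool) → Prop} (P : (E₁ → Bool) → Prop)
    (hP : ∀ o i, P (merge (InCS Z₁ st v z) o i) ↔ P o) (i : E₁ → Bool) :
    (univ.filter fun ω : E₁ → Bool => V (merge (InCS Z₁ st v z) ω i) ∧ P ω).card =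
      (InSupp (InCS Z₁ st v z)).card * fibCS Z₁ st z v V P i := by
  unfold fibCS
  rw [card_filter_outOnly (InCS Z₁ st v z) _ fun ω => ?_]
  rw [merge_outN_left]
  conv_lhs => rw [← merge_outN_inN (InCS Z₁ st v z) ω]
  rw [hP, merge_outN_inN]

open Classical in
/-- The conjecture on `stOut` bounds the crossed fibre count by the `(⊤, ⊥)` fibre count, fibre by fibre. -/
theorem fib_cycS_le {V : (E₁ → Bool) → Prop} (hV : UpSet V) (h1 : CycDominationS Z₁ x y v (stOutS Z₁ st v z))
    (i : E₁ → Bool) :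
    fibCS Z₁ st z v V (CycCrossedS Z₁ x y v (stOutS Z₁ st v z)) i ≤ fibCS Z₁ st z v V (TopBotS Z₁ x y v (stOutS Z₁ st v z)) i := by
  have h := h1 (fun ω => V (merge (InCS Z₁ st v z) ω i)) (upSet_fibreOut _ hV i)
  rw [card_outOnly_eq_fibS Z₁ st z v (CycCrossedS Z₁ x y v (stOutS Z₁ st v z)) (cycCrossedS_stOutS_merge Z₁ st x y z v),
    card_outOnly_eq_fibS Z₁ st z v (TopBotS Z₁ x y v (stOutS Z₁ st v z)) (topBotS_stOutS_merge Z₁ st x y z v)] at h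
  exact Nat.le_of_mul_le_mul_left h (card_InSupp_pos _)

open Classical in
/-- The sibling domination on `stOut` bounds the two sibling fibre counts by the target's, fibre by fibre. -/
theorem fib_sibS_le {V : (E₁ → Bool) → Prop} (hV : UpSet V) (h2 : SibDominationS Z₁ x y v (stOutS Z₁ st v z))
    (i : E₁ → Bool) :
    fibCS Z₁ st z v V (SibC₁ Z₁ x y v (stOutS Z₁ st v z)) i + fibCS Z₁ st z v V (SibC₃ Z₁ x y v (stOutS Z₁ st v z)) i ≤
      fibCS Z₁ st z v V (SibTop Z₁ x y v (stOutS Z₁ st v z)) i := by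
  have h := h2 (fun ω => V (merge (InCS Z₁ st v z) ω i)) (upSet_fibreOut _ hV i)
  have hL := card_outOnly_eq_fibS Z₁ st z v (V := V)
    (fun o => SibC₁ Z₁ x y v (stOutS Z₁ st v z) o ∨ SibC₃ Z₁ x y v (stOutS Z₁ st v z) o)
    (fun o i => or_congr (sibC₁_stOutS_merge Z₁ st x y z v o i) (sibC₃_stOutS_merge Z₁ st x y z v o i)) i
  have hR := card_outOnly_eq_fibS Z₁ st z v (V := V) (SibTop Z₁ x y v (stOutS Z₁ st v z)) (sibTop_stOutS_merge Z₁ st x y z v) i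
  rw [← fibS_or Z₁ st z v (fun o h1 h3 => h3.2.1 h1.1)]
  refine Nat.le_of_mul_le_mul_left ?_ (card_InSupp_pos (InCS Z₁ st v z))
  rw [← hL, ← hR]
  exact (card_filter_inst.trans_le h).trans_eq card_filter_inst

/-! ## The transport of the `B`-fibres -/

open Classical in
/-- The `B`-type inside parts. -/
noncomputable def InBS : Finset (E₁ → Bool) := (InSupp (InCS Z₁ st v z)).filter (tBinS Z₁ st z v)

open Classical in
/-- The `R`-type inside parts. -/
noncomputable def InRS : Finset (E₁ → Bool) := (InSupp (InCS Z₁ st v z)).filter (tRinS Z₁ st z v)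

open Classical in
/-- Hall's condition for the transport: on every up-set the `B`-type inside parts are outnumbered by the `R`-type
ones (THEOREM (TWO-MARK DOMINATION) on `stIn`, pulled back along the inside part). -/
theorem hall_InBS_InRS (V : (E₁ → Bool) → Prop) (hV : UpSet V) :
    ((InBS Z₁ st z v).filter V).card ≤ ((InRS Z₁ st z v).filter V).card := by
  have h := count_blue_only_le_count_red_only_S Z₁ (stInS Z₁ st v z) v z (upSet_pullIn (InCS Z₁ st v z) hV)
  have hin : ∀ P : (E₁ → Bool) → Prop,
      (∀ ω, P ω ↔ P (inN (InCS Z₁ st v z) ω)) →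
      (univ.filter fun ω : E₁ → Bool => V (inN (InCS Z₁ st v z) ω) ∧ P ω).card =
        (OutSupp (InCS Z₁ st v z)).card * ((InSupp (InCS Z₁ st v z)).filter fun i => V (inN (InCS Z₁ st v z) i) ∧ P i).card := by
    intro P hP
    rw [card_filter_inOnly (InCS Z₁ st v z) _ fun ω => ?_]
    rw [inN_inN, ← hP]
  have hL := hin (fun ω => MgS Z₁ (stInS Z₁ st v z) ω v z ∧ ¬ RdS Z₁ (stInS Z₁ st v z) ω v z)
    (fun ω => by rw [MgS_stInS_inN Z₁ st v z ω, RdS_stInS_inN Z₁ st v z ω])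
  have hR := hin (fun ω => RdS Z₁ (stInS Z₁ st v z) ω v z ∧ ¬ MgS Z₁ (stInS Z₁ st v z) ω v z)
    (fun ω => by rw [MgS_stInS_inN Z₁ st v z ω, RdS_stInS_inN Z₁ st v z ω])
  have h' := (hL.symm.trans card_filter_inst).trans_le (h.trans_eq (card_filter_inst.trans hR))
  have h'' := Nat.le_of_mul_le_mul_left h' (card_OutSupp_pos _)
  unfold InBS InRS
  rw [Finset.filter_filter, Finset.filter_filter]
  exact (card_filter_congr' fun i hi => by rw [inN_eq_self _ hi]; unfold tBinS; tauto).trans_le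
    (h''.trans_eq (card_filter_congr' fun i hi => by rw [inN_eq_self _ hi]; unfold tRinS; tauto))

open Classical in
/-- **THE TRANSPORT**: a red-ward injection of the `B`-type inside parts into the `R`-type ones. -/
theorem exists_transportS : ∃ φ : (E₁ → Bool) → (E₁ → Bool), Set.InjOn φ ↑(InBS Z₁ st z v) ∧
    ∀ i ∈ InBS Z₁ st z v, φ i ∈ InRS Z₁ st z v ∧ LeCol i (φ i) :=
  exists_monotone_injection (InBS Z₁ st z v) (InRS Z₁ st z v) (hall_InBS_InRS Z₁ st z v)

/-! ## The gluing theorem -/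

open Classical in
/-- The crossed count of a fibre, sorted by the type of its inside part. -/
theorem fibre_cycS (hz : z ≠ v) (hx : x ∉ side Z₁ st v z)
    (hy : y ∉ side Z₁ st v z) (V : (E₁ → Bool) → Prop) (i : E₁ → Bool) :
    ((OutSupp (InCS Z₁ st v z)).filter fun o =>
        V (merge (InCS Z₁ st v z) o i) ∧ CycCrossedS Z₁ x y z st (merge (InCS Z₁ st v z) o i)).card =
      (if tDinS Z₁ st z v i then fibCS Z₁ st z v V (CycCrossedS Z₁ x y v (stOutS Z₁ st v z)) i else 0) +
        (if tRinS Z₁ st z v i then fibCS Z₁ st z v V (SibC₃ Z₁ x y v (stOutS Z₁ st v z)) i else 0) +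
        (if tBinS Z₁ st z v i then fibCS Z₁ st z v V (SibC₁ Z₁ x y v (stOutS Z₁ st v z)) i else 0) := by
  rw [Finset.filter_congr fun o _ => and_congr_right fun _ => cycCrossedS_merge_iff Z₁ st x y z v hz hx hy o i]
  unfold fibCS
  by_cases hR : RdS Z₁ (stInS Z₁ st v z) i v z <;> by_cases hB : MgS Z₁ (stInS Z₁ st v z) i v z
  all_goals
    simp only [tDinS, tRinS, tBinS, hR, hB, and_self, not_true_eq_false, not_false_eq_true, and_false, and_true,
      true_and, false_and, or_false, false_or, if_true, if_false, add_zero, zero_add]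
  all_goals first
    | rfl
    | simp only [Finset.filter_false, Finset.card_empty]

open Classical in
/-- The `(⊤, ⊥)` count of a fibre, sorted by the type of its inside part. -/
theorem fibre_topS (hz : z ≠ v) (hx : x ∉ side Z₁ st v z)
    (hy : y ∉ side Z₁ st v z) (V : (E₁ → Bool) → Prop) (i : E₁ → Bool) :
    ((OutSupp (InCS Z₁ st v z)).filter fun o =>
        V (merge (InCS Z₁ st v z) o i) ∧ TopBotS Z₁ x y z st (merge (InCS Z₁ st v z) o i)).card =
      (if tDinS Z₁ st z v i then fibCS Z₁ st z v V (TopBotS Z₁ x y v (stOutS Z₁ st v z)) i else 0) +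
        (if tRinS Z₁ st z v i then fibCS Z₁ st z v V (SibTop Z₁ x y v (stOutS Z₁ st v z)) i else 0) := by
  rw [Finset.filter_congr fun o _ => and_congr_right fun _ => topBotS_merge_iff Z₁ st x y z v hz hx hy o i]
  unfold fibCS
  by_cases hR : RdS Z₁ (stInS Z₁ st v z) i v z <;> by_cases hB : MgS Z₁ (stInS Z₁ st v z) i v z
  all_goals
    simp only [tDinS, tRinS, hR, hB, and_self, not_true_eq_false, not_false_eq_true, and_false, and_true,
      true_and, false_and, or_false, false_or, if_true, if_false, add_zero, zero_add]
  all_goals first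
    | rfl
    | simp only [Finset.filter_false, Finset.card_empty]

open Classical in
/-- THEOREM (CUT-VERTEX GLUING), fibre form: the `D`-fibres bounded one by one (by whatever means), the sibling
domination on the near side, and the transport of the `B`-fibres give the conjecture. -/
theorem cycDominationS_of_cutVertex_fibres (hz : z ≠ v) (hx : x ∉ side Z₁ st v z)
    (hy : y ∉ side Z₁ st v z)
    (hD : ∀ V : (E₁ → Bool) → Prop, UpSet V → ∀ i ∈ (InSupp (InCS Z₁ st v z)).filter (tDinS Z₁ st z v),
      fibCS Z₁ st z v V (CycCrossedS Z₁ x y v (stOutS Z₁ st v z)) i ≤ fibCS Z₁ st z v V (TopBotS Z₁ x y v (stOutS Z₁ st v z)) i)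
    (h2 : SibDominationS Z₁ x y v (stOutS Z₁ st v z)) : CycDominationS Z₁ x y z st := by
  intro V hV
  obtain ⟨φ, hinj, hφ⟩ := exists_transportS Z₁ st z v
  rw [card_filter_eq_sum_fibre (InCS Z₁ st v z), card_filter_eq_sum_fibre (InCS Z₁ st v z)]
  rw [Finset.sum_congr rfl fun i _ => fibre_cycS Z₁ st x y z v hz hx hy V i,
    Finset.sum_congr rfl fun i _ => fibre_topS Z₁ st x y z v hz hx hy V i]
  rw [Finset.sum_add_distrib, Finset.sum_add_distrib, Finset.sum_add_distrib, ← Finset.sum_filter,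
    ← Finset.sum_filter, ← Finset.sum_filter, ← Finset.sum_filter, ← Finset.sum_filter]
  -- the `D`-fibres
  have hD : ∑ i ∈ (InSupp (InCS Z₁ st v z)).filter (tDinS Z₁ st z v),
      fibCS Z₁ st z v V (CycCrossedS Z₁ x y v (stOutS Z₁ st v z)) i ≤
      ∑ i ∈ (InSupp (InCS Z₁ st v z)).filter (tDinS Z₁ st z v), fibCS Z₁ st z v V (TopBotS Z₁ x y v (stOutS Z₁ st v z)) i :=
    Finset.sum_le_sum fun i hi => hD V hV i hi
  -- the `B`-fibres are transported into the `R`-fibres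
  have hB : ∑ i ∈ InBS Z₁ st z v, fibCS Z₁ st z v V (SibC₁ Z₁ x y v (stOutS Z₁ st v z)) i ≤
      ∑ i ∈ InRS Z₁ st z v, fibCS Z₁ st z v V (SibC₁ Z₁ x y v (stOutS Z₁ st v z)) i := by
    calc ∑ i ∈ InBS Z₁ st z v, fibCS Z₁ st z v V (SibC₁ Z₁ x y v (stOutS Z₁ st v z)) i
        ≤ ∑ i ∈ InBS Z₁ st z v, fibCS Z₁ st z v V (SibC₁ Z₁ x y v (stOutS Z₁ st v z)) (φ i) :=
          Finset.sum_le_sum fun i hi => fibS_mono Z₁ st z v hV _ (hφ i hi).2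
      _ = ∑ j ∈ (InBS Z₁ st z v).image φ, fibCS Z₁ st z v V (SibC₁ Z₁ x y v (stOutS Z₁ st v z)) j := by
          rw [Finset.sum_image fun i hi i' hi' h => hinj (Finset.mem_coe.mpr hi) (Finset.mem_coe.mpr hi') h]
      _ ≤ ∑ j ∈ InRS Z₁ st z v, fibCS Z₁ st z v V (SibC₁ Z₁ x y v (stOutS Z₁ st v z)) j := by
          apply Finset.sum_le_sum_of_subset
          intro j hj
          obtain ⟨i, hi, rfl⟩ := Finset.mem_image.mp hj
          exact (hφ i hi).1
  -- the `R`-fibres carry the sibling domination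
  have hR : ∑ i ∈ InRS Z₁ st z v, fibCS Z₁ st z v V (SibC₁ Z₁ x y v (stOutS Z₁ st v z)) i +
      ∑ i ∈ InRS Z₁ st z v, fibCS Z₁ st z v V (SibC₃ Z₁ x y v (stOutS Z₁ st v z)) i ≤
      ∑ i ∈ InRS Z₁ st z v, fibCS Z₁ st z v V (SibTop Z₁ x y v (stOutS Z₁ st v z)) i := by
    rw [← Finset.sum_add_distrib]
    exact Finset.sum_le_sum fun i _ => fib_sibS_le Z₁ st x y z v hV h2 i
  calc ∑ i ∈ (InSupp (InCS Z₁ st v z)).filter (tDinS Z₁ st z v), fibCS Z₁ st z v V (CycCrossedS Z₁ x y v (stOutS Z₁ st v z)) i +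
        ∑ i ∈ (InSupp (InCS Z₁ st v z)).filter (tRinS Z₁ st z v), fibCS Z₁ st z v V (SibC₃ Z₁ x y v (stOutS Z₁ st v z)) i +
        ∑ i ∈ (InSupp (InCS Z₁ st v z)).filter (tBinS Z₁ st z v), fibCS Z₁ st z v V (SibC₁ Z₁ x y v (stOutS Z₁ st v z)) i
      ≤ ∑ i ∈ (InSupp (InCS Z₁ st v z)).filter (tDinS Z₁ st z v), fibCS Z₁ st z v V (TopBotS Z₁ x y v (stOutS Z₁ st v z)) i +
        ∑ i ∈ InRS Z₁ st z v, fibCS Z₁ st z v V (SibC₃ Z₁ x y v (stOutS Z₁ st v z)) i +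
        ∑ i ∈ InRS Z₁ st z v, fibCS Z₁ st z v V (SibC₁ Z₁ x y v (stOutS Z₁ st v z)) i :=
        add_le_add (add_le_add hD le_rfl) hB
    _ = ∑ i ∈ (InSupp (InCS Z₁ st v z)).filter (tDinS Z₁ st z v), fibCS Z₁ st z v V (TopBotS Z₁ x y v (stOutS Z₁ st v z)) i +
        (∑ i ∈ InRS Z₁ st z v, fibCS Z₁ st z v V (SibC₁ Z₁ x y v (stOutS Z₁ st v z)) i +
          ∑ i ∈ InRS Z₁ st z v, fibCS Z₁ st z v V (SibC₃ Z₁ x y v (stOutS Z₁ st v z)) i) := by ring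
    _ ≤ ∑ i ∈ (InSupp (InCS Z₁ st v z)).filter (tDinS Z₁ st z v), fibCS Z₁ st z v V (TopBotS Z₁ x y v (stOutS Z₁ st v z)) i +
        ∑ i ∈ (InSupp (InCS Z₁ st v z)).filter (tRinS Z₁ st z v), fibCS Z₁ st z v V (SibTop Z₁ x y v (stOutS Z₁ st v z)) i :=
        add_le_add le_rfl hR

open Classical in
/-- **THEOREM (CUT-VERTEX GLUING FOR THE DOMINATION CONJECTURE)**: if `v` separates the mark `z` from the marks
`x, y`, and the host with the `z`-side deleted satisfies the conjecture for `(x, y, v)` and the sibling domination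
for `(x, y; v)`, then the host satisfies the conjecture for `(x, y, z)`. -/
theorem cycDominationS_of_cutVertex (hz : z ≠ v) (hx : x ∉ side Z₁ st v z)
    (hy : y ∉ side Z₁ st v z) (h1 : CycDominationS Z₁ x y v (stOutS Z₁ st v z))
    (h2 : SibDominationS Z₁ x y v (stOutS Z₁ st v z)) : CycDominationS Z₁ x y z st :=
  cycDominationS_of_cutVertex_fibres Z₁ st x y z v hz hx hy (fun _ hV i _ => fib_cycS_le Z₁ st x y z v hV h1 i) h2

end MultiExit

end ZoneZ

end PercRepro
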